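import Summits.Ventures.HSemireg.WedgePointPairPowersPerQSupport
import Summits.Ventures.HSemireg.FormulaNPerQUniform
import Summits.Ventures.HSemireg.WedgeSurfacePowersPerQRank

/-!
# Venture HSemireg — per-`q` blocks of the `n`-fold box of `m`-dimensional point pairs, 4/4: THE RANK THEOREM
# `rank(q-block of θ ↦ θ ∧ F ∣ ⋀^k K^{(m+m)n}) = genCount m n k q = [t^k u^q] G_{m,n}(t,u)` for EVERY `m ≥ 1`, `n`, `k`, `q` —
# the conjecture of `FormulaNPerQUniform.lean` as a theorem (th-6's per-q law and the surface-power law are its two edges)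

HONEST FRAMING. Part of the Lean index of the computation cell `pub-hsemireg` (seat p10 gen 3, Sunday typer «UNIFORM-IN-n»).
Finite-dimensional EXTERIOR ALGEBRA over a field (and integer polynomial arithmetic) ONLY: no variety, no cohomology theory, no sheaf, no
Ext group, no semiregularity map is constructed here; nothing here says that HC / HC_CM / HC_AV holds; no Literature fact is declared or
used.  Custodian versions: STRUCTURE.md v1.0-SIGNED 9b196a05977dd067 (§1.1 C10 / C13), theory/FORMULA-N.md PART A §4.1″ (th-6), PART B (th-7).

THIS FILE: §1 disjoint-support independence; §2 the range of the `q`-block of `θ ↦ θ ∧ F` on `⋀^k` is the span of the reached class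
vectors of degree `k`, so **block rank = `|Fset m n k q|`** (`finrank_range_blockProj_wedge_pairBox_eq_card`); §3 THE COUNT: the local
weights sum to `w + R_m(t,u)`, `R_m = Q_m − 1 − u^m` (`sum_wt`: the `X`-sources give `w + (u+t)^m − u^m`, the proper `Y`-sources
`(1+t)^m − 1 − t^m`, binomial theorem), hence `Σ_f w^z t^k u^{q_f} = (w + R_m)ⁿ` (`sum_prod_wt`), `|Nset| = C(n,z)·[t^k u^{q_f}]R_m^{n−z}`
(`card_Nset`, via `FormulaNPerQUniform.coeff_Rb_pow`) and **`|Fset m n k q| = genCount m n k q`** (`card_Fset`); §4 **THE PER-`q` RANK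
THEOREM UNIFORM IN `n` AND `m`** (`finrank_range_blockProj_wedge_pairBox`, `…_eq_coeff_genGen`) and the pre-registered `m = 3` rows as
rank statements (`perq_rows_threefold_triple`).  WHAT IS NOT HERE: anything Ext-side (bridge `σ∘ev = ⌟ch` and Ext counts by value as
always); `m = 0` (no letters).  Namespace `Summit.Ventures.HSemireg.Wedge.PairPowers`.
-/

open Module Set Set.powersetCard Polynomial

namespace Summit.Ventures.HSemireg.Wedge.PairPowers

open Summit.Ventures.HSemireg.Wedge Summit.Ventures.HSemireg.Wedge.Kunneth

variable (K : Type*) [Field K] {m : ℕ}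

variable {n : ℕ}

/-! ## §2. The range of the `q`-block of `θ ↦ θ ∧ F` on `⋀^k` is spanned by the class vectors it reaches -/

/-- the DEGREE of option data (total size of the canonical source). -/
def kf (f : Fin n → Opt m) : ℕ := ∑ i, ((f i).1).card

/-- the degree is the size of the canonical source. -/
lemma kf_eq_card_src (f : Fin n → Opt m) : kf f = (src f).card := (card_src f).symm

variable (m n)

/-- the option data of degree `k` whose class REACHES block `q` (`q = q_f + jm`, `j ≤ z`). -/
def Fset (k q : ℕ) : Finset (Fin n → Opt m) :=
  Finset.univ.filter fun f => kf f = k ∧ ∃ j : Fin (zf f + 1), q = qff f + m * (j : ℕ)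

variable {m n}

/-- membership in `Fset`. -/
lemma mem_Fset {k q : ℕ} {f : Fin n → Opt m} : f ∈ Fset m n k q ↔ kf f = k ∧ ∃ j, j ≤ zf f ∧ q = qff f + m * j := by
  rw [Fset, Finset.mem_filter, and_iff_right (Finset.mem_univ f)]
  exact and_congr Iff.rfl ⟨fun ⟨j, h⟩ => ⟨j, Nat.lt_succ_iff.mp j.2, h⟩, fun ⟨j, hj, h⟩ => ⟨⟨j, Nat.lt_succ_iff.mpr hj⟩, h⟩⟩

/-- **every source image is `0` or a multiple of a class vector of the same degree** (local classification on every block; a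
dead block kills the image). -/
theorem lprod_eq_smul_vec (hm : 1 ≤ m) {a c : K} (hc : c ≠ 0) (s : Finset (Fin ((m + m) * n))) :
    lprod K a c s n = 0 ∨ ∃ f : Fin n → Opt m, kf f = s.card ∧ ∃ Λ : K, lprod K a c s n = Λ • vec K a c f := by
  by_cases hdead : ∃ i, B K (Fin (m + m)) (pb m n i s) * pp K m a c = 0
  · left
    obtain ⟨i, hi⟩ := hdead
    apply lprod_eq_zero_of_limg K a c s i
    rw [limg_eq_emb, hi, map_zero]
  · right
    have hcl : ∀ i : Fin n, ∃ o : Opt m, o.1.card = (pb m n i s).card ∧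
        ∃ μ : K, B K (Fin (m + m)) (pb m n i s) * pp K m a c = μ • (B K (Fin (m + m)) o.1 * pp K m a c) :=
      fun i => (local_class hm hc (pb m n i s)).resolve_left (not_exists.mp hdead i)
    choose f hf1 hf2 using hcl
    choose μ hμ using hf2
    refine ⟨f, ?_, ?_⟩
    · rw [kf, card_eq_sum_card_pb s]
      exact Finset.sum_congr rfl fun i _ => hf1 i
    · have h : ∀ i, limg K a c s i = μ i • limg K a c (src f) i := by
        intro i
        rw [limg_eq_emb, limg_eq_emb, pb_src, hμ, map_smul]
      exact lprod_smul_of_limg K a c s (src f) μ h n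

/-- **the range of the `q`-block of `θ ↦ θ ∧ F` on `⋀^k K^{(m+m)n}` is the span of the `q`-components of the class vectors of
degree `k` reaching `q`** (`m ≥ 1`, `a, c ≠ 0`). -/
theorem range_blockProj_wedge_pairBox (hm : 1 ≤ m) {a c : K} (ha : a ≠ 0) (hc : c ≠ 0) (k q : ℕ) :
    LinearMap.range (blockProj K m n q ∘ₗ wedge K (Fin ((m + m) * n)) k (pairBox K (m := m) (n := n) a c)) =
      Submodule.span K (Set.range fun f : Fset m n k q => blockProj K m n q (vec K a c f.1)) := by
  apply le_antisymm
  · rw [LinearMap.range_comp, range_wedge, Submodule.map_span, Submodule.span_le]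
    rintro _ ⟨_, ⟨s, hs, rfl⟩, rfl⟩
    rw [SetLike.mem_coe]
    show blockProj K m n q (B K (Fin ((m + m) * n)) s * pairBox K (m := m) (n := n) a c) ∈ _
    obtain ⟨μ, -, e⟩ := B_mul_pairBox K hm ha hc s
    rw [e, map_smul]
    apply Submodule.smul_mem
    rcases lprod_eq_smul_vec K hm hc s with h0 | ⟨f, hf, Λ, hΛ⟩
    · rw [h0, map_zero]; exact Submodule.zero_mem _
    · rw [hΛ, map_smul]
      apply Submodule.smul_mem
      by_cases hr : ∃ j, j ≤ zf f ∧ q = qff f + m * j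
      · exact Submodule.subset_span ⟨⟨f, mem_Fset.mpr ⟨hf.trans hs, hr⟩⟩, rfl⟩
      · rw [← blockProj_vec_ne_zero_iff K hm ha hc f q, not_ne_iff] at hr
        rw [hr]; exact Submodule.zero_mem _
  · rw [Submodule.span_le]
    rintro _ ⟨⟨f, hf⟩, rfl⟩
    obtain ⟨hk, -⟩ := mem_Fset.mp hf
    obtain ⟨μ, hμ, e⟩ := B_mul_pairBox K hm ha hc (src f)
    have hv : vec K a c f = μ⁻¹ • (B K (Fin ((m + m) * n)) (src f) * pairBox K (m := m) (n := n) a c) := by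
      rw [e, smul_smul, inv_mul_cancel₀ hμ, one_smul]; rfl
    rw [SetLike.mem_coe]
    show blockProj K m n q (vec K a c f) ∈ _
    rw [hv, map_smul]
    apply Submodule.smul_mem
    exact ⟨⟨B K (Fin ((m + m) * n)) (src f), SurfacePowers.B_mem_exteriorPower K (by rw [← kf_eq_card_src, hk])⟩, rfl⟩

/-- **BLOCK RANK = NUMBER OF CLASSES REACHING THE BLOCK**: `rank(q-block of θ ↦ θ ∧ F ∣ ⋀^k) = |Fset m n k q|`. -/
theorem finrank_range_blockProj_wedge_pairBox_eq_card (hm : 1 ≤ m) {a c : K} (ha : a ≠ 0) (hc : c ≠ 0) (k q : ℕ) :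
    finrank K (LinearMap.range (blockProj K m n q ∘ₗ wedge K (Fin ((m + m) * n)) k (pairBox K (m := m) (n := n) a c))) =
      (Fset m n k q).card := by
  rw [range_blockProj_wedge_pairBox K hm ha hc, finrank_span_eq_card, Fintype.card_coe]
  apply SurfacePowers.linearIndependent_of_disjoint_support
  · rintro ⟨f, hf⟩
    exact (blockProj_vec_ne_zero_iff K hm ha hc f q).mpr (mem_Fset.mp hf).2
  · rintro ⟨f, hf⟩ ⟨f', hf'⟩ hne T
    simp only [coord_blockProj]
    split_ifs
    · exact coord_vec_eq_zero_or K hm ha hc (fun h => hne (Subtype.ext h)) T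
    · exact Or.inl rfl



/-! ## §3. Counting the classes: `|Fset m n k q| = genCount m n k q` (trivariate generating function `(w + R_m(t,u))ⁿ`) -/

/-- the WEIGHT `w^z t^k u^{q_f}` of a canonical local source, in `ℤ[u][t][w]`, as a function of the underlying letter set. -/
noncomputable def wtT (m : ℕ) (t : Finset (Fin (m + m))) : ℤ[X][X][X] :=
  C (C ((X : ℤ[X]) ^ (if t ⊆ Xs m ∧ t ≠ ∅ then m - t.card else 0)) * (X : ℤ[X][X]) ^ t.card) *
    (X : ℤ[X][X][X]) ^ (if t = ∅ then 1 else 0)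

/-- the weight of a canonical local source. -/
noncomputable def wt (o : Opt m) : ℤ[X][X][X] := C (C ((X : ℤ[X]) ^ lqf m o) * (X : ℤ[X][X]) ^ o.1.card) * (X : ℤ[X][X][X]) ^ lz m o

/-- `wt o = wtT o.1`. -/
lemma wt_eq (o : Opt m) : wt o = wtT m o.1 := rfl

/-- the weight of option data is the product of the local weights: `w^{z(f)} t^{k(f)} u^{q_f(f)}`. -/
lemma prod_wt (f : Fin n → Opt m) :
    ∏ i, wt (f i) = C (C ((X : ℤ[X]) ^ qff f) * (X : ℤ[X][X]) ^ kf f) * (X : ℤ[X][X][X]) ^ zf f := by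
  simp only [wt, Finset.prod_mul_distrib, ← map_prod, Finset.prod_pow_eq_pow_sum]
  rfl

/-- binomial bookkeeping: `(y + t)^m − y^m = Σ_{j<m} C(m,j+1)·t^{j+1}·y^{m−(j+1)}` (the `j = 0` term removed). -/
lemma add_pow_sub_pow (y : ℤ[X][X]) (m : ℕ) :
    (y + X) ^ m - y ^ m = ∑ j ∈ Finset.range m, (m.choose (j + 1) : ℤ[X][X]) * (X ^ (j + 1) * y ^ (m - (j + 1))) := by
  rw [add_comm, add_pow, Finset.sum_range_succ']
  simp only [pow_zero, one_mul, Nat.sub_zero, Nat.choose_zero_right, Nat.cast_one, mul_one, add_sub_cancel_right]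
  exact Finset.sum_congr rfl fun j _ => by ring

/-- the `X`-sources: `Σ_{t ⊆ X} wtT t = w + C((u+t)^m − u^m)`. -/
lemma sum_wtT_powerset_X :
    ∑ t ∈ (Xs m).powerset, wtT m t = X + C ((C X + X) ^ m - C ((X : ℤ[X]) ^ m)) := by
  have h1 : ∀ t ∈ (Xs m).powerset, wtT m t =
      (fun j : ℕ => if j = 0 then (X : ℤ[X][X][X]) else C (C ((X : ℤ[X]) ^ (m - j)) * (X : ℤ[X][X]) ^ j)) t.card := by
    intro t ht
    rw [Finset.mem_powerset] at ht
    by_cases h0 : t = ∅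
    · subst h0; simp [wtT]
    · have hc : t.card ≠ 0 := fun h => h0 (Finset.card_eq_zero.mp h)
      simp only [wtT, if_pos (And.intro ht h0), if_neg h0, if_neg hc, pow_zero, mul_one]
  rw [Finset.sum_congr rfl h1,
    Finset.sum_powerset_apply_card
      (fun j : ℕ => if j = 0 then (X : ℤ[X][X][X]) else C (C ((X : ℤ[X]) ^ (m - j)) * (X : ℤ[X][X]) ^ j)),
    WedgePair.card_Xset, Finset.sum_range_succ', show C ((X : ℤ[X]) ^ m) = (C X : ℤ[X][X]) ^ m from (map_pow C X m),
    add_pow_sub_pow, map_sum, add_comm]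
  simp only [Nat.choose_zero_right, one_smul, Nat.succ_ne_zero, if_false, nsmul_eq_mul]
  congr 1
  refine Finset.sum_congr rfl fun j _ => ?_
  simp only [map_mul, map_natCast, map_pow]
  ring

/-- binomial bookkeeping: `(1 + t)^m − 1 − t^m = Σ_{j ≤ m} C(m,j)·[0 < j < m]·t^j` (`m ≥ 1`). -/
lemma one_add_pow_sub (hm : 1 ≤ m) :
    (1 + (X : ℤ[X][X])) ^ m - 1 - X ^ m =
      ∑ j ∈ Finset.range (m + 1), (m.choose j : ℤ[X][X]) * (if 0 < j ∧ j < m then X ^ j else 0) := by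
  have hfull : (1 + (X : ℤ[X][X])) ^ m = ∑ j ∈ Finset.range (m + 1), (m.choose j : ℤ[X][X]) * X ^ j := by
    rw [add_comm, add_pow]
    exact Finset.sum_congr rfl fun j _ => by rw [one_pow, mul_one, mul_comm]
  have hsplit : ∑ j ∈ Finset.range (m + 1), (m.choose j : ℤ[X][X]) * X ^ j =
      ∑ j ∈ Finset.range (m + 1), (m.choose j : ℤ[X][X]) * (if 0 < j ∧ j < m then X ^ j else 0) +
        ∑ j ∈ Finset.range (m + 1), (m.choose j : ℤ[X][X]) * (if 0 < j ∧ j < m then 0 else X ^ j) := by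
    rw [← Finset.sum_add_distrib]
    exact Finset.sum_congr rfl fun j _ => by split_ifs <;> ring
  have hends : ∑ j ∈ Finset.range (m + 1), (m.choose j : ℤ[X][X]) * (if 0 < j ∧ j < m then 0 else X ^ j) = 1 + X ^ m := by
    rw [Finset.sum_eq_add_of_mem 0 m (Finset.mem_range.mpr (by omega)) (Finset.mem_range.mpr (by omega)) (by omega)]
    · simp
    · intro j hj hne
      rw [Finset.mem_range] at hj
      rw [if_pos ⟨by omega, by omega⟩, mul_zero]
  rw [hfull, hsplit, hends]
  ring

/-- the non-empty proper `Y`-sources: `Σ wtT t = C((1+t)^m − 1 − t^m)` (`m ≥ 1`). -/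
lemma sum_wtT_filter_Y (hm : 1 ≤ m) :
    ∑ t ∈ (Ys m).powerset.filter (fun t => 0 < t.card ∧ t.card < m), wtT m t = C ((1 + X) ^ m - 1 - (X : ℤ[X][X]) ^ m) := by
  have h1 : ∀ t ∈ (Ys m).powerset, (if 0 < t.card ∧ t.card < m then wtT m t else 0) =
      (fun j : ℕ => if 0 < j ∧ j < m then C ((X : ℤ[X][X]) ^ j) else (0 : ℤ[X][X][X])) t.card := by
    intro t ht
    rw [Finset.mem_powerset] at ht
    simp only
    split_ifs with h
    · have h0 : t ≠ ∅ := fun e => by rw [e, Finset.card_empty] at h; omega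
      have hX : ¬ (t ⊆ Xs m ∧ t ≠ ∅) := fun hh =>
        h0 (eq_empty_of_disjoint (WedgePair.disjoint_X_iff_subset_Y.mpr ht) (WedgePair.disjoint_Y_iff_subset_X.mpr hh.1))
      simp only [wtT, if_neg hX, if_neg h0, pow_zero, map_one, one_mul, mul_one, map_pow]
    · rfl
  rw [Finset.sum_filter, Finset.sum_congr rfl h1,
    Finset.sum_powerset_apply_card (fun j : ℕ => if 0 < j ∧ j < m then C ((X : ℤ[X][X]) ^ j) else (0 : ℤ[X][X][X])),
    WedgePair.card_Yset, one_add_pow_sub hm, map_sum]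
  refine Finset.sum_congr rfl fun j _ => ?_
  simp only [nsmul_eq_mul]
  split_ifs with h
  · rw [map_mul, map_natCast, map_pow]
  · simp

/-- **the local weights sum to `w + R_m(t,u)`** (`R_m = Q_m − 1 − u^m` of `FormulaNPerQUniform.lean`; `m ≥ 1`). -/
theorem sum_wt (hm : 1 ≤ m) : ∑ o : Opt m, wt o = X + C (FormulaN.Uniform.Rb m) := by
  have hdisj : Disjoint (Xs m).powerset ((Ys m).powerset.filter fun t => 0 < t.card ∧ t.card < m) := by
    rw [Finset.disjoint_left]
    intro t h1 h2
    rw [Finset.mem_powerset] at h1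
    rw [Finset.mem_filter, Finset.mem_powerset] at h2
    have := eq_empty_of_disjoint (WedgePair.disjoint_X_iff_subset_Y.mpr h2.1) (WedgePair.disjoint_Y_iff_subset_X.mpr h1)
    rw [this, Finset.card_empty] at h2
    omega
  rw [show (∑ o : Opt m, wt o) = ∑ t ∈ optSet m, wtT m t from Finset.sum_coe_sort (optSet m) (wtT m), optSet,
    Finset.sum_union hdisj, sum_wtT_powerset_X, sum_wtT_filter_Y hm, FormulaN.Uniform.Rb, FormulaN.Uniform.Q, add_assoc, ← map_add]
  congr 2
  ring

/-- **the generating function**: `Σ_f w^{z(f)} t^{k(f)} u^{q_f(f)} = (w + R_m(t,u))ⁿ` (`m ≥ 1`). -/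
theorem sum_prod_wt (hm : 1 ≤ m) : ∑ f : Fin n → Opt m, ∏ i, wt (f i) = (X + C (FormulaN.Uniform.Rb m)) ^ n := by
  rw [← sum_wt hm, ← Fintype.piFinset_univ,
    ← Finset.prod_univ_sum (fun _ : Fin n => (Finset.univ : Finset (Opt m))) (fun _ o => wt o),
    Finset.prod_const, Finset.card_univ, Fintype.card_fin]

/-- the coefficient of one weight is the indicator of its exponents. -/
lemma coeff_prod_wt (f : Fin n → Opt m) (z k qf : ℕ) :
    (((∏ i, wt (f i)).coeff z).coeff k).coeff qf = if zf f = z ∧ kf f = k ∧ qff f = qf then 1 else 0 := by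
  rw [prod_wt, coeff_C_mul_X_pow]
  by_cases hz : zf f = z
  · rw [if_pos hz.symm, coeff_C_mul_X_pow]
    by_cases hk : kf f = k
    · rw [if_pos hk.symm, coeff_X_pow]
      by_cases hq : qff f = qf
      · rw [if_pos hq.symm, if_pos ⟨hz, hk, hq⟩]
      · rw [if_neg (Ne.symm hq), if_neg (fun h => hq h.2.2)]
    · rw [if_neg (Ne.symm hk), Polynomial.coeff_zero, if_neg (fun h => hk h.2.1)]
  · rw [if_neg (Ne.symm hz), Polynomial.coeff_zero, Polynomial.coeff_zero, if_neg (fun h => hz h.1)]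

variable (m n)

/-- the option data with `z` empty blocks, degree `k` and fixed part `q_f`. -/
def Nset (z k qf : ℕ) : Finset (Fin n → Opt m) := Finset.univ.filter fun f => zf f = z ∧ kf f = k ∧ qff f = qf

variable {m n}

/-- their number is a coefficient of the generating function. -/
lemma card_Nset_eq_coeff (hm : 1 ≤ m) (z k qf : ℕ) :
    ((Nset m n z k qf).card : ℤ) = ((((X + C (FormulaN.Uniform.Rb m) : ℤ[X][X][X]) ^ n).coeff z).coeff k).coeff qf := by
  rw [← sum_prod_wt hm, finsetSum_coeff, finsetSum_coeff, finsetSum_coeff]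
  simp_rw [coeff_prod_wt]
  rw [Finset.sum_boole, Nset]

/-- **`|Nset m n z k q_f| = C(n,z) · [t^k u^{q_f}] R_m^{n−z}`** (`= C(n,z) · rbPow m (n−z) k q_f`, `FormulaNPerQUniform.coeff_Rb_pow`). -/
theorem card_Nset (hm : 1 ≤ m) (z k qf : ℕ) :
    (Nset m n z k qf).card = n.choose z * FormulaN.Uniform.rbPow m (n - z) k qf := by
  have h := card_Nset_eq_coeff (n := n) hm z k qf
  rw [coeff_X_add_C_pow, coeff_mul_natCast, coeff_mul_natCast, FormulaN.Uniform.coeff_Rb_pow hm, mul_comm] at h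
  exact_mod_cast h

/-- the reach indicator as a sum over the candidate shifts `j` (at most one `j` fits, `m ≥ 1`). -/
lemma ite_reach_eq_sum (hm : 1 ≤ m) (f : Fin n → Opt m) (k q : ℕ) :
    (if kf f = k ∧ ∃ j : Fin (zf f + 1), q = qff f + m * (j : ℕ) then 1 else 0) =
      ∑ j ∈ Finset.range (zf f + 1), (if kf f = k ∧ q = qff f + m * j then 1 else 0) := by
  by_cases hk : kf f = k
  · simp only [hk, true_and]
    rw [Finset.sum_boole, Nat.cast_id]
    have hle : ((Finset.range (zf f + 1)).filter fun j => q = qff f + m * j).card ≤ 1 :=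
      Finset.card_le_one.mpr fun a ha b hb => by
        rw [Finset.mem_filter] at ha hb
        exact Nat.eq_of_mul_eq_mul_left hm (by omega)
    split_ifs with hj
    · obtain ⟨j, hj⟩ := hj
      refine le_antisymm ?_ hle
      rw [Nat.one_le_iff_ne_zero, Ne, Finset.card_eq_zero, ← Ne, ← Finset.nonempty_iff_ne_empty]
      exact ⟨j, Finset.mem_filter.mpr ⟨Finset.mem_range.mpr j.2, hj⟩⟩
    · rw [eq_comm, Finset.card_eq_zero, Finset.filter_eq_empty_iff]
      intro j hjr h
      exact hj ⟨⟨j, Finset.mem_range.mp hjr⟩, h⟩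
  · simp [hk]

/-- the number of empty blocks is at most `n`. -/
lemma zf_le (f : Fin n → Opt m) : zf f ≤ n := by
  rw [zf_eq_card]
  exact (Finset.card_le_univ _).trans (by rw [Fintype.card_fin])

/-- in the fibre `z(f) = z`: the classes of degree `k` reaching `q` with shift `j` number `[mj ≤ q] · |Nset z k (q − mj)|`. -/
lemma sum_fiber_eq (z k q j : ℕ) :
    ∑ f ∈ Finset.univ.filter (fun f : Fin n → Opt m => zf f = z), (if kf f = k ∧ q = qff f + m * j then 1 else 0) =
      if m * j ≤ q then (Nset m n z k (q - m * j)).card else 0 := by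
  split_ifs with hj
  · rw [Finset.sum_boole, Nat.cast_id, Finset.filter_filter, Nset]
    congr 1
    ext f
    simp only [Finset.mem_filter, Finset.mem_univ, true_and]
    omega
  · exact Finset.sum_eq_zero fun f _ => if_neg fun h => hj (by omega)

/-- **THE COUNT: `|Fset m n k q| = genCount m n k q`** — p10's general corrected enumerator of `FormulaNPerQUniform.lean`
(sum over the number `z` of empty blocks and the shift `j ≤ z`, `q_f = q − mj`). -/
theorem card_Fset (hm : 1 ≤ m) (k q : ℕ) : (Fset m n k q).card = FormulaN.Uniform.genCount m n k q := by
  rw [Fset, Finset.card_filter]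
  simp_rw [ite_reach_eq_sum hm]
  rw [← Finset.sum_fiberwise_of_maps_to (s := Finset.univ) (t := Finset.range (n + 1)) (g := zf)
    (fun f _ => Finset.mem_range.mpr (Nat.lt_succ_of_le (zf_le f))), FormulaN.Uniform.genCount]
  refine Finset.sum_congr rfl fun z _ => ?_
  rw [Finset.sum_congr rfl (fun f hf => by rw [(Finset.mem_filter.mp hf).2]), Finset.sum_comm, Finset.mul_sum]
  refine Finset.sum_congr rfl fun j _ => ?_
  rw [sum_fiber_eq, card_Nset hm, mul_ite, mul_zero]

/-! ## §4. THE PER-`q` RANK THEOREM for the `n`-fold box of `m`-dimensional point pairs, every `m ≥ 1`, `n`, `k`, `q` -/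

/-- **THE PER-`q` RANK THEOREM, UNIFORM IN `n` AND `m`.**  For every field `K`, every `m ≥ 1`, every `n`, every degree `k`, every
block `q` and `a, c ≠ 0`: the rank of the `q`-block of `θ ↦ θ ∧ F` on `⋀^k K^{(m+m)n}` (`F = f₀ ∧ ⋯ ∧ f_{n−1}`, `f_i = a·E_{X_i} + c·E_{Y_i}`
the `m`-dimensional point pairs; `q` = number of `X`-generators missing from the target monomial) is
`genCount m n k q = [t^k u^q] G_{m,n}(t,u)`, `G_{m,n} = Σ_z C(n,z)(1 + u^m + ⋯ + u^{zm})(Q_m − 1 − u^m)^{n−z}` — the CONJECTURE of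
`FormulaNPerQUniform.lean` (there typed on the edges `m = 2` and `n = 2` only) as a theorem. -/
theorem finrank_range_blockProj_wedge_pairBox (hm : 1 ≤ m) {a c : K} (ha : a ≠ 0) (hc : c ≠ 0) (k q : ℕ) :
    finrank K (LinearMap.range (blockProj K m n q ∘ₗ wedge K (Fin ((m + m) * n)) k (pairBox K (m := m) (n := n) a c))) =
      FormulaN.Uniform.genCount m n k q := by
  rw [finrank_range_blockProj_wedge_pairBox_eq_card K hm ha hc, card_Fset hm]

/-- the generating-function form: `rank = [t^k u^q] G_{m,n}(t,u)`. -/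
theorem finrank_range_blockProj_wedge_pairBox_eq_coeff_genGen (hm : 1 ≤ m) {a c : K} (ha : a ≠ 0) (hc : c ≠ 0) (k q : ℕ) :
    (finrank K (LinearMap.range (blockProj K m n q ∘ₗ wedge K (Fin ((m + m) * n)) k (pairBox K (m := m) (n := n) a c))) : ℤ) =
      ((FormulaN.Uniform.genGen m n).coeff k).coeff q := by
  rw [finrank_range_blockProj_wedge_pairBox K hm ha hc, FormulaN.Uniform.coeff_genGen hm]

/-- **the pre-registered `m = 3` rows are now RANK statements**: the triple box (`n = 3`) of threefold point pairs (`18` generators),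
degrees 1, 2, 3: `(9,0,9,9,0,9,9,0,9,0)`, `(36,9,54,36,36,54,9,36,0,0)`, `(84,54,135,111,135,54,84,0,0,0)`
(`FormulaN.Uniform.genCount_predictions_three`). -/
theorem perq_rows_threefold_triple {a c : K} (ha : a ≠ 0) (hc : c ≠ 0) :
    (List.range 10).map (fun q => finrank K (LinearMap.range
        (blockProj K 3 3 q ∘ₗ wedge K (Fin ((3 + 3) * 3)) 1 (pairBox K (m := 3) (n := 3) a c)))) = [9, 0, 9, 9, 0, 9, 9, 0, 9, 0] ∧
    (List.range 10).map (fun q => finrank K (LinearMap.range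
        (blockProj K 3 3 q ∘ₗ wedge K (Fin ((3 + 3) * 3)) 2 (pairBox K (m := 3) (n := 3) a c)))) = [36, 9, 54, 36, 36, 54, 9, 36, 0, 0] ∧
    (List.range 10).map (fun q => finrank K (LinearMap.range
        (blockProj K 3 3 q ∘ₗ wedge K (Fin ((3 + 3) * 3)) 3 (pairBox K (m := 3) (n := 3) a c)))) =
      [84, 54, 135, 111, 135, 54, 84, 0, 0, 0] := by
  simp only [finrank_range_blockProj_wedge_pairBox K (show 1 ≤ 3 by norm_num) ha hc]
  exact FormulaN.Uniform.genCount_predictions_three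

/-- **EDGE `m = 2` of the enumerators**: `genCount 2 n k q = spCount n k q` — the general theorem at `m = 2` gives the surface-power
ranks of `WedgeSurfacePowersPerQRank.finrank_range_blockProj_wedge_surfaceBox` (via `FormulaN.Uniform.genGen_two`). -/
theorem genCount_two_eq_spCount (n k q : ℕ) : FormulaN.Uniform.genCount 2 n k q = FormulaN.Uniform.spCount n k q := by
  have h1 := FormulaN.Uniform.coeff_genGen (show 1 ≤ 2 by norm_num) n k q
  rw [FormulaN.Uniform.coeff_genGen_two] at h1
  exact_mod_cast h1.symm

/-- **EDGE `n = 2`**: `genCount m 2 k q = blockCount m k q` for `k ≥ 1` — the general theorem at two factors gives th-6's per-q law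
(`WedgeBoxPerQCount`, there in th-7's `WedgeBox` model; via `FormulaN.Uniform.genGen_two_factors`). -/
theorem genCount_two_factors_eq_blockCount (hm : 1 ≤ m) {k : ℕ} (hk : 1 ≤ k) (q : ℕ) :
    FormulaN.Uniform.genCount m 2 k q = FormulaN.Uniform.blockCount m k q := by
  have h1 := FormulaN.Uniform.coeff_genGen hm 2 k q
  rw [FormulaN.Uniform.coeff_genGen_two_factors hk] at h1
  exact_mod_cast h1.symm

end Summit.Ventures.HSemireg.Wedge.PairPowers
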